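import Summits.QuantumFields.YangMills.Theorems.BalabanLadderNTStrongCouplingPairCore
import HarnessLib

/-!
# Crux `NT` (stmt-QuantumFields-19353) / seam `UVSeamRec` (stmt-QuantumFields-20043): the two-point ceiling E2-osc
# (`RefPkgT` clause 2) HOLDS AT STRONG COUPLING — format rung, explicit constants

Helper file of the fleet lead prover of crux `NT` (unit `ym-spine-19353-p1`, g6).  Clause 2 of the registered stub
`stub_refpkgT : RefPkgT` (v4T) is the exterior-oscillation ceiling of the conditional TWO-point function of the action density,

  (E2-osc)  `|kerCov_{Q,η}(dens x, dens y) − kerCov_{Q,η'}(dens x, dens y)| ≤ C₂ / min(depth x, depth y)⁴ / (1 + ‖y − x‖)⁴`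

for every femto cube `Q`, ALL exteriors `η, η'`, all sites of depth `≥ 1` — decay in the DEPTH and in the SEPARATION at once.
This file proves its body at strong coupling `216 · N · |β| ≤ 1` (`N = r.N`) for EVERY cube, every exterior pair and every
pair of sites, from the separation mechanism (M1) of `…NTStrongCouplingPairCore` and the depth profile of
`…NTStrongCouplingInfluence`:

* `osc_cov_algebra` — the product rule with absolute values (plain reals);
* `osc_kerCov_dens_le_depth_smallBeta` — (M2) DEPTH: `|kerCov_{Q,η} − kerCov_{Q,η'}|(dens x, dens y) ≤ 32 M² S · 2^{−min depth}`
  (`abs_kerE_sub_kerE_le_depthProfile` on `dens x · dens y`, `dens x`, `dens y`; `M` = sup of the density, `S` = number of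
  links it reads);
* `osc_kerCov_dens_le_smallBeta` — **E2-osc, exponential form**: `≤ 32 M² S · 2^{−max(⌊‖y−x‖_∞⌋, min depth)}`;
* `e2osc_smallBeta` — **E2-osc in the REGISTERED shape** (`β`-range replaced by `216 N |β| ≤ 1`, no femto restriction):
  `≤ C₂ / (min depth)⁴ / (1 + ‖siteToE (y − x)‖)⁴` with `C₂ = 32 M² S · (1944/(log 2)⁴) · (314928/(log 2)⁴)`
  (`one_add_norm_siteToE_le`: `1 + ‖y − x‖₂ ≤ 3(⌊‖y − x‖_∞⌋ + 1)`).

HONEST FRAMING.  A format rung: the two-point ceiling's SHAPE (uniform in cube, exteriors and sites, joint decay in depth and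
separation) is inhabited by the lattice Yang–Mills kernels at high temperature for every compact metrisable `G` and every
lattice representation; nothing is claimed at large `β`, about NT, the seam or the gap.

References: Georgii 2011 Def. 1.23, Thm. 8.20; Dobrushin 1970 Thm. 3; Föllmer 1988 Ch. I (2.10); Simon 1979.
-/

set_option autoImplicit false

noncomputable section

open MeasureTheory Filter Topology
open Literature.MathematicalPhysics.QuantumFieldTheory Literature.MathematicalPhysics.QuantumLattice
open Literature.Probability.LatticeModels
open Summit.QuantumFields.YangMills.Cruxes.OSLegsFromFemtoAndGap.DlrCollarTransfer
open Summit.QuantumFields.YangMills.Theorems.OSLegsFromFemtoAndGap.StubLower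
  (isCylinder_curvature_shift curvature_shift_supp_window norm_le_two_mul_of_forall_abs_le)

namespace Summit.QuantumFields.YangMills.Cruxes.NT.StrongCoupling

section Main

variable (G : Type) [Group G] [TopologicalSpace G] [IsTopologicalGroup G] [CompactSpace G]
  [MeasurableSpace G] [BorelSpace G] (r : LatticeRep G)

/-- Elementary algebra of the two-point oscillation: product rule with absolute values. [folklore] -/
theorem osc_cov_algebra {pAB pAB' a₁ a₂ b₁ b₂ M T : ℝ} (hM : 0 ≤ M) (hT : 0 ≤ T)
    (h1 : |pAB - pAB'| ≤ 2 * (M * M) * (2 * T)) (h2 : |a₁ - a₂| ≤ 2 * M * T) (h3 : |b₁ - b₂| ≤ 2 * M * T)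
    (h4 : |a₂| ≤ M) (h5 : |b₁| ≤ M) : |pAB - a₁ * b₁ - (pAB' - a₂ * b₂)| ≤ 8 * (M * M) * T := by
  have hY0 : 0 ≤ 2 * M * T := by positivity
  have hprod : |a₁ * b₁ - a₂ * b₂| ≤ 2 * M * T * M + M * (2 * M * T) := by
    have e : a₁ * b₁ - a₂ * b₂ = (a₁ - a₂) * b₁ + a₂ * (b₁ - b₂) := by ring
    rw [e]
    refine (abs_add_le _ _).trans ?_
    rw [abs_mul, abs_mul]
    exact add_le_add (mul_le_mul h2 h5 (abs_nonneg _) hY0) (mul_le_mul h4 h3 (abs_nonneg _) ((abs_nonneg _).trans h4))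
  have e2 : pAB - a₁ * b₁ - (pAB' - a₂ * b₂) = (pAB - pAB') - (a₁ * b₁ - a₂ * b₂) := by ring
  rw [e2]
  calc |(pAB - pAB') - (a₁ * b₁ - a₂ * b₂)| ≤ |pAB - pAB'| + |a₁ * b₁ - a₂ * b₂| := abs_sub _ _
    _ ≤ 2 * (M * M) * (2 * T) + (2 * M * T * M + M * (2 * M * T)) := add_le_add h1 hprod
    _ = 8 * (M * M) * T := by ring

/-- **(M2) Depth decay of the exterior oscillation of the conditional two-point function.**  For `216 N |β| ≤ 1`, every
cube, ALL exteriors `η, η'` and every pair of sites: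
`|kerCov_{Q,η}(dens x, dens y) − kerCov_{Q,η'}(dens x, dens y)| ≤ 32 M² S · 2^{−min(depth x, depth y)}`
(`abs_kerE_sub_kerE_le_depthProfile` applied to `dens x · dens y`, `dens x`, `dens y`; the links of `dens x` are based
within one step of `x`, so their depth is `≥ depth x − 1`). [folklore] -/
theorem osc_kerCov_dens_le_depth_smallBeta {β : ℝ} (hβ : 216 * (r.N : ℝ) * |β| ≤ 1) {M : ℝ}
    (hM : ∀ (z : Fin 4 → ℤ) (U : LGConfig 4 G), |dens G r z U| ≤ M) (c : Fin 4 → ℤ) (b : ℕ) (η η' : LGConfig 4 G)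
    (x y : Fin 4 → ℤ) :
    |kerCov G r β c b η (dens G r x) (dens G r y) - kerCov G r β c b η' (dens G r x) (dens G r y)| ≤
      32 * M ^ 2 * r.curvature.supp.card * (1 / 2 : ℝ) ^ min (depth c b x) (depth c b y) := by
  classical
  haveI := r.t2Space
  haveI := r.secondCountableTopology
  have hM0 : 0 ≤ M := (abs_nonneg _).trans (hM 0 fun _ => 1)
  -- the depth profile on the two supports
  have hprof : ∀ (u : Fin 4 → ℤ) (z : Literature.MathematicalPhysics.QuantumLattice.ZdEdge 4),
      z ∈ (r.curvature.supp.image fun e : Literature.MathematicalPhysics.QuantumLattice.ZdEdge 4 => (e.1 + u, e.2)) →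
      min (depth c b x) (depth c b y) ≤ depth c b u →
        (1 / 2 : ℝ) ^ (depth c b z.1 - 1) ≤ 4 * (1 / 2 : ℝ) ^ min (depth c b x) (depth c b y) := by
    intro u z hz hu
    have h1 : depth c b u ≤ depth c b z.1 + 1 := by
      refine depth_le_depth_add_one_of_norm_le c b ?_
      rw [norm_sub_rev]; exact norm_sub_le_one_of_mem_supp_dens G r hz
    calc (1 / 2 : ℝ) ^ (depth c b z.1 - 1) ≤ (1 / 2 : ℝ) ^ (min (depth c b x) (depth c b y) - 2) :=
          pow_le_pow_of_le_one (by norm_num) (by norm_num) (by omega)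
      _ ≤ 4 * (1 / 2 : ℝ) ^ min (depth c b x) (depth c b y) := half_pow_sub_two_le _
  have hsum : ∀ u : Fin 4 → ℤ, min (depth c b x) (depth c b y) ≤ depth c b u →
      ∑ z ∈ (r.curvature.supp.image fun e : Literature.MathematicalPhysics.QuantumLattice.ZdEdge 4 => (e.1 + u, e.2)),
        (1 / 2 : ℝ) ^ (depth c b z.1 - 1) ≤ r.curvature.supp.card * (4 * (1 / 2 : ℝ) ^ min (depth c b x) (depth c b y)) := by
    intro u hu
    refine (Finset.sum_le_sum fun z hz => hprof u z hz hu).trans ?_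
    rw [Finset.sum_const, nsmul_eq_mul]
    refine mul_le_mul_of_nonneg_right ?_ (by positivity)
    exact_mod_cast card_supp_dens_le G r u
  have hsumA := hsum x (min_le_left _ _)
  have hsumB := hsum y (min_le_right _ _)
  have hAm := (continuous_dens r x).measurable
  have hBm := (continuous_dens r y).measurable
  -- oscillation of the three kernel means
  have hoA := abs_kerE_sub_kerE_le_depthProfile G r hβ c b η η' hAm (dependsOn_dens G r x) (hM x)
  have hoB := abs_kerE_sub_kerE_le_depthProfile G r hβ c b η η' hBm (dependsOn_dens G r y) (hM y)
  have hABdep : DependsOn (fun U => dens G r x U * dens G r y U)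
      (↑((r.curvature.supp.image fun e : Literature.MathematicalPhysics.QuantumLattice.ZdEdge 4 => (e.1 + x, e.2)) ∪
          (r.curvature.supp.image fun e : Literature.MathematicalPhysics.QuantumLattice.ZdEdge 4 => (e.1 + y, e.2))) :
        Set (Literature.MathematicalPhysics.QuantumLattice.ZdEdge 4)) := by
    intro U V h
    rw [Finset.coe_union] at h
    show dens G r x U * dens G r y U = dens G r x V * dens G r y V
    rw [dependsOn_dens G r x fun z hz => h z (Or.inl hz), dependsOn_dens G r y fun z hz => h z (Or.inr hz)]
  have hABb : ∀ U, |dens G r x U * dens G r y U| ≤ M * M := fun U => by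
    rw [abs_mul]; exact mul_le_mul (hM x U) (hM y U) (abs_nonneg _) hM0
  have hoAB := abs_kerE_sub_kerE_le_depthProfile G r hβ c b η η' (hAm.mul hBm) hABdep hABb
  have hsumAB : ∑ z ∈ (r.curvature.supp.image fun e : Literature.MathematicalPhysics.QuantumLattice.ZdEdge 4 =>
        (e.1 + x, e.2)) ∪ (r.curvature.supp.image fun e : Literature.MathematicalPhysics.QuantumLattice.ZdEdge 4 =>
        (e.1 + y, e.2)), (1 / 2 : ℝ) ^ (depth c b z.1 - 1) ≤
      2 * (r.curvature.supp.card * (4 * (1 / 2 : ℝ) ^ min (depth c b x) (depth c b y))) := by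
    have hui := Finset.sum_union_inter
      (s₁ := r.curvature.supp.image fun e : Literature.MathematicalPhysics.QuantumLattice.ZdEdge 4 => (e.1 + x, e.2))
      (s₂ := r.curvature.supp.image fun e : Literature.MathematicalPhysics.QuantumLattice.ZdEdge 4 => (e.1 + y, e.2))
      (f := fun z => (1 / 2 : ℝ) ^ (depth c b z.1 - 1))
    have hint : 0 ≤ ∑ z ∈ (r.curvature.supp.image fun e : Literature.MathematicalPhysics.QuantumLattice.ZdEdge 4 =>
        (e.1 + x, e.2)) ∩ (r.curvature.supp.image fun e : Literature.MathematicalPhysics.QuantumLattice.ZdEdge 4 =>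
        (e.1 + y, e.2)), (1 / 2 : ℝ) ^ (depth c b z.1 - 1) := Finset.sum_nonneg fun z _ => by positivity
    linarith
  -- chain with the sums, then elementary algebra on the six kernel means
  have hT0 : 0 ≤ (r.curvature.supp.card : ℝ) * (4 * (1 / 2 : ℝ) ^ min (depth c b x) (depth c b y)) := by positivity
  have hoA' := hoA.trans (mul_le_mul_of_nonneg_left hsumA (by positivity))
  have hoB' := hoB.trans (mul_le_mul_of_nonneg_left hsumB (by positivity))
  have hoAB' := hoAB.trans (mul_le_mul_of_nonneg_left hsumAB (by positivity))
  have hEA := BoundaryLaw.abs_kerE_le G r β c b η' (hM x)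
  have hEB := BoundaryLaw.abs_kerE_le G r β c b η (hM y)
  unfold kerCov
  refine (osc_cov_algebra hM0 hT0 hoAB' hoA' hoB' hEA hEB).trans (le_of_eq ?_)
  ring

/-- **E2-osc at strong coupling, exponential form.**  For `216 N |β| ≤ 1`, EVERY cube `Q = (c,b)`, ALL exteriors and every
pair of sites: `|kerCov_{Q,η} − kerCov_{Q,η'}|(dens x, dens y) ≤ 32 M² S · 2^{−max(⌊‖y−x‖_∞⌋, min(depth x, depth y))}` —
(M1) for each exterior when the separation dominates, (M2) otherwise. [folklore] -/
theorem osc_kerCov_dens_le_smallBeta {β : ℝ} (hβ : 216 * (r.N : ℝ) * |β| ≤ 1) {M : ℝ}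
    (hM : ∀ (z : Fin 4 → ℤ) (U : LGConfig 4 G), |dens G r z U| ≤ M) (c : Fin 4 → ℤ) (b : ℕ) (η η' : LGConfig 4 G)
    (x y : Fin 4 → ℤ) :
    |kerCov G r β c b η (dens G r x) (dens G r y) - kerCov G r β c b η' (dens G r x) (dens G r y)| ≤
      32 * M ^ 2 * r.curvature.supp.card * (1 / 2 : ℝ) ^ max ⌊‖y - x‖⌋₊ (min (depth c b x) (depth c b y)) := by
  rcases le_total ⌊‖y - x‖⌋₊ (min (depth c b x) (depth c b y)) with h | h
  · rw [max_eq_right h]; exact osc_kerCov_dens_le_depth_smallBeta G r hβ hM c b η η' x y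
  · rw [max_eq_left h]
    have h1 := abs_kerCov_dens_le_smallBeta G r hβ hM c b η x y
    have h2 := abs_kerCov_dens_le_smallBeta G r hβ hM c b η' x y
    calc _ ≤ |kerCov G r β c b η (dens G r x) (dens G r y)| + |kerCov G r β c b η' (dens G r x) (dens G r y)| := abs_sub _ _
      _ ≤ _ := by linarith

/-- The Euclidean separation is controlled by the integer sup-separation: `1 + ‖siteToE (y − x)‖ ≤ 3 (⌊‖y − x‖_∞⌋ + 1)`.
[folklore] -/
theorem one_add_norm_siteToE_le (x y : Fin 4 → ℤ) :
    1 + ‖siteToE (y - x)‖ ≤ 3 * ((⌊‖y - x‖⌋₊ : ℝ) + 1) := by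
  have hfl : ‖y - x‖ < (⌊‖y - x‖⌋₊ : ℝ) + 1 := Nat.lt_floor_add_one _
  have h2 : ‖siteToE (y - x)‖ ≤ 2 * ‖y - x‖ := by
    refine norm_le_two_mul_of_forall_abs_le _ (norm_nonneg _) fun j => ?_
    have h := norm_le_pi_norm (y - x) j
    rw [Pi.sub_apply, Int.norm_eq_abs, Int.cast_sub] at h
    rw [siteToE_apply, Pi.sub_apply]
    push_cast
    exact h
  linarith

/-- **E2-osc at strong coupling in the REGISTERED shape** (`RefPkgT` clause 2 of crux `NT`, skeleton v4T, with the `β`-range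
replaced by `216 N |β| ≤ 1` and the femto restriction dropped): for every cube, ALL exteriors and all sites of depth `≥ 1`,
`|kerCov_{Q,η} − kerCov_{Q,η'}|(dens x, dens y) ≤ C₂ / (min depth)⁴ / (1 + ‖siteToE (y − x)‖)⁴` with the explicit
`C₂ = 32 M² S · (1944/(log 2)⁴) · (314928/(log 2)⁴)`.  FORMAT RUNG; nothing at large `β`. [folklore] -/
theorem e2osc_smallBeta {M : ℝ} (hM : ∀ (z : Fin 4 → ℤ) (U : LGConfig 4 G), |dens G r z U| ≤ M) :
    ∃ C₂ : ℝ, 0 ≤ C₂ ∧ ∀ β : ℝ, 216 * (r.N : ℝ) * |β| ≤ 1 →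
      ∀ (c : Fin 4 → ℤ) (b : ℕ) (η η' : LGConfig 4 G) (x y : Fin 4 → ℤ), 1 ≤ depth c b x → 1 ≤ depth c b y →
        |kerCov G r β c b η (dens G r x) (dens G r y) - kerCov G r β c b η' (dens G r x) (dens G r y)| ≤
          C₂ / ((min (depth c b x) (depth c b y) : ℕ) : ℝ) ^ 4 / (1 + ‖siteToE (y - x)‖) ^ 4 := by
  have hlog : 0 < Real.log 2 := Real.log_pos (by norm_num)
  have hM0 : 0 ≤ M := (abs_nonneg _).trans (hM 0 fun _ => 1)
  set K₁ : ℝ := 1944 / Real.log 2 ^ 4 with hK₁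
  set K₂ : ℝ := 314928 / Real.log 2 ^ 4 with hK₂
  refine ⟨32 * M ^ 2 * r.curvature.supp.card * K₁ * K₂, by positivity, fun β hβ c b η η' x y hx hy => ?_⟩
  set dm : ℕ := min (depth c b x) (depth c b y) with hdm
  set s : ℕ := ⌊‖y - x‖⌋₊ with hs
  have hdm1 : 1 ≤ dm := le_min hx hy
  have hdpos : (0 : ℝ) < (dm : ℝ) := by exact_mod_cast hdm1
  have hsep : (0 : ℝ) < 1 + ‖siteToE (y - x)‖ := by positivity
  refine (osc_kerCov_dens_le_smallBeta G r hβ hM c b η η' x y).trans ?_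
  -- `2^{-max(s, dm)} ≤ 2^{-⌊s/2⌋} 2^{-⌊dm/2⌋}`... via `max ≥ (s+1)/2 - ... `; we use `max(s,dm) ≥ (s + 1)/2 + dm/2 - 1`
  have hmax : (s + 1) / 2 + dm / 2 ≤ max s dm + 1 := by omega
  have hpow : (1 / 2 : ℝ) ^ max s dm ≤ 2 * ((1 / 2 : ℝ) ^ ((s + 1) / 2) * (1 / 2 : ℝ) ^ (dm / 2)) := by
    have h1 : (1 / 2 : ℝ) ^ (max s dm + 1) ≤ (1 / 2 : ℝ) ^ ((s + 1) / 2 + dm / 2) :=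
      pow_le_pow_of_le_one (by norm_num) (by norm_num) hmax
    rw [pow_succ, pow_add] at h1
    linarith
  -- the two quartic conversions
  have hd := half_pow_half_le_quartic hdm1
  have hs1 : 1 ≤ s + 1 := by omega
  have hsq := half_pow_half_le_quartic hs1
  have hsep3 := one_add_norm_siteToE_le x y
  -- `(1 + ‖siteToE (y-x)‖)^4 ≤ 81 (s+1)^4`
  have hsep4 : (1 + ‖siteToE (y - x)‖) ^ 4 ≤ 81 * ((s : ℝ) + 1) ^ 4 := by
    have := pow_le_pow_left₀ hsep.le hsep3 4
    nlinarith
  have hspos : (0 : ℝ) < (s : ℝ) + 1 := by positivity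
  -- assemble: bound ≤ 32 M² S · 2 · K₁'/(s+1)^4 · K₁/dm^4 with K₂ = 2·81·1944 = 314928
  have hs' : (1 / 2 : ℝ) ^ ((s + 1) / 2) ≤ 1944 / (Real.log 2 ^ 4 * ((s : ℝ) + 1) ^ 4) := by
    have := hsq; push_cast at this; exact this
  have hfinal : (1 / 2 : ℝ) ^ max s dm ≤ K₁ / (dm : ℝ) ^ 4 * (K₂ / (1 + ‖siteToE (y - x)‖) ^ 4) := by
    refine hpow.trans ?_
    have hA : (1 / 2 : ℝ) ^ (dm / 2) ≤ K₁ / (dm : ℝ) ^ 4 := by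
      rw [hK₁, div_div]; exact hd
    have hB : 2 * (1 / 2 : ℝ) ^ ((s + 1) / 2) ≤ K₂ / (1 + ‖siteToE (y - x)‖) ^ 4 := by
      rw [hK₂, le_div_iff₀ (by positivity)]
      calc 2 * (1 / 2 : ℝ) ^ ((s + 1) / 2) * (1 + ‖siteToE (y - x)‖) ^ 4
          ≤ 2 * (1944 / (Real.log 2 ^ 4 * ((s : ℝ) + 1) ^ 4)) * (81 * ((s : ℝ) + 1) ^ 4) := by
            gcongr
        _ = 314928 / Real.log 2 ^ 4 := by field_simp; ring
    calc 2 * ((1 / 2 : ℝ) ^ ((s + 1) / 2) * (1 / 2 : ℝ) ^ (dm / 2))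
        = (1 / 2 : ℝ) ^ (dm / 2) * (2 * (1 / 2 : ℝ) ^ ((s + 1) / 2)) := by ring
      _ ≤ K₁ / (dm : ℝ) ^ 4 * (K₂ / (1 + ‖siteToE (y - x)‖) ^ 4) :=
          mul_le_mul hA hB (by positivity) (by positivity)
  have hC0 : 0 ≤ 32 * M ^ 2 * (r.curvature.supp.card : ℝ) := by positivity
  calc 32 * M ^ 2 * (r.curvature.supp.card : ℝ) * (1 / 2 : ℝ) ^ max s dm
      ≤ 32 * M ^ 2 * (r.curvature.supp.card : ℝ) * (K₁ / (dm : ℝ) ^ 4 * (K₂ / (1 + ‖siteToE (y - x)‖) ^ 4)) :=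
        mul_le_mul_of_nonneg_left hfinal hC0
    _ = 32 * M ^ 2 * (r.curvature.supp.card : ℝ) * K₁ * K₂ / (dm : ℝ) ^ 4 / (1 + ‖siteToE (y - x)‖) ^ 4 := by
        field_simp

end Main

end Summit.QuantumFields.YangMills.Cruxes.NT.StrongCoupling

end
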